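import Literature.Computability.QuantumComplexity.ZXCalculusControlAlphaAssembly
import HarnessLib

/-!
# ZX-calculus: JPV LICS 2019, Lemma `2Id-is-C2-times-anti-C2` (NF-L2)

`((Z^{(0,1)} ⨾ Tᵗ) ⊗ (Z^{(0,1)} ⨾ T)) ⨾ Z^{(2,1)} = Z^{(0,0)} ⊗ Z^{(0,1)}`: the green state copied through the red split,
`T = X(π) ⨾ Tᵗ ⨾ X(π)`, and `control-alpha-with-triangles` at `α = 0`, as printed.
[cite: JeandelPerdrixVilmart2018, Appendix Lemma 21; JPV, *A Generic Normal Form for ZX-Diagrams* (LICS 2019), Appendix]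
-/

namespace Literature.Computability.QuantumComplexity

open ZXDiagram

namespace ZXClass

/-- (B1), green version: `√2 ⊗ (Z^{(0,1)} ⨾ X^{(1,2)}) = Z^{(0,1)} ⊗ Z^{(0,1)}`. [cite: JeandelPerdrixVilmart2018, Fig. 1 (B1)] -/
theorem rule_B1_green : mk (dumbbell 0 0) ⊠ (mk (Z 0 1 0) ⨟ mk (X 1 2 0)) = mk (Z 0 1 0) ⊠ mk (Z 0 1 0) := by
  have h := congrArg colorSwap rule_B1
  simpa using h

/-- **JPV LICS 2019, Lemma `2Id-is-C2-times-anti-C2`**: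
`((Z^{(0,1)} ⨾ Tᵗ) ⊗ (Z^{(0,1)} ⨾ T)) ⨾ Z^{(2,1)} = Z^{(0,0)} ⊗ Z^{(0,1)}`.
[cite: JeandelPerdrixVilmart2018, Appendix Lemma 21; JPV LICS 2019 Appendix (proof of `2Id-is-C2-times-anti-C2`)] -/
theorem two_id_is_c2_times_anti_c2 :
    ((mk (Z 0 1 0) ⨟ (mk triangle).transpose) ⊠ (mk (Z 0 1 0) ⨟ mk triangle)) ⨟ mk (Z 2 1 0) = mk (Z 0 0 0) ⊠ mk (Z 0 1 0) := by
  -- `control-alpha-with-triangles` at `α = 0`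
  have h0 := control_alpha_with_triangles 0
  rw [mul_zero, neg_zero, Z_one_one, id_seq, id_seq, seq_id, xLeafL_zero_zero] at h0
  nth_rewrite 2 [triangle_eq_conj_transpose]
  rw [← seq_assoc (mk (Z 0 1 0)) (mk (X 1 1 4) ⨟ (mk triangle).transpose) (mk (X 1 1 4)), ← seq_assoc (mk (Z 0 1 0)) (mk (X 1 1 4)) ((mk triangle).transpose),
    Z_state_zero_seq_X_phase, seq_assoc (mk (Z 0 1 0)) ((mk triangle).transpose) (mk (X 1 1 4)), ← interchange,
    show (mk (Z 0 1 0) ⊠ mk (Z 0 1 0)) = mk (dumbbell 0 0) ⊠ (mk (Z 0 1 0) ⨟ mk (X 1 2 0)) from rule_B1_green.symm,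
    seq_assoc, show ∀ (s : ZXClass 0 0) (A : ZXClass 0 2) (B : ZXClass 2 1), (s ⊠ A) ⨟ B = s ⊠ (A ⨟ B) from fun s A B => by
      rw [scalar_par_seq_left, empty_par, cast_id],
    seq_assoc (mk (Z 0 1 0)) (mk (X 1 2 0)), ← seq_assoc (mk (X 1 2 0)), h0, scalar_par_state_seq_right, ← seq_assoc, Z_seq_Z 0 1 0 le_rfl, add_zero (0 : ZMod 8),
    scalar_par_state_seq_right', par_assoc_scalar (mk (Z 0 0 0)) (mk (Z 0 1 0)), invSqrtTwo_par_sqrt_two_scalar]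
  where
  scalar_par_state_seq_right (A : ZXClass 0 1) (s : ZXClass 0 0) (B : ZXClass 1 1) : A ⨟ (s ⊠ B) = s ⊠ (A ⨟ B) := by
    rw [scalar_par_seq_right, empty_par, cast_id]
  scalar_par_state_seq_right' (A : ZXClass 0 0) (B : ZXClass 0 1) : mk (dumbbell 0 0) ⊠ (mk invSqrtTwo ⊠ (A ⨟ B)) = (mk (dumbbell 0 0) ⊠ mk invSqrtTwo) ⊠ (A ⨟ B) :=
    (par_assoc' _ _ _).trans (cast_id _ _ _)
  par_assoc_scalar (A : ZXClass 0 0) (B : ZXClass 0 1) : (A ⨟ B : ZXClass 0 1) = A ⊠ B := by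
    rw [par_eq_seq_left A B, par_empty, empty_par, cast_id]
  invSqrtTwo_par_sqrt_two_scalar (Y : ZXClass 0 1) : (mk (dumbbell 0 0) ⊠ mk invSqrtTwo) ⊠ Y = Y := by
    rw [scalar_par_comm, invSqrtTwo_par_dumbbell, empty_par, cast_id]

end ZXClass

end Literature.Computability.QuantumComplexity
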